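import Summits.CriticalPhenomena.PercolationContinuityZ3.Theorems.PercNearOneGluingNoHeavyQuantTwoMidCellRates
import Summits.CriticalPhenomena.PercolationContinuityZ3.Theorems.PercNearOneGluingNoHeavyQuantTwoMidCellPolyD
import Summits.CriticalPhenomena.PercolationContinuityZ3.Theorems.PercNearOneGluingNoHeavyQuantTwoMidCellPolyE
import HarnessLib

/-!
# QUANT lane R8, T-DEC: the TWO-MID CELL of `LightSliceLowCrossBelow` — RATE LEMMAS for bracket 1 (the expensive row) and the COUPLING
# through the giant share of `M2` (census-2 g60)

builds on p205010 (kernel theorem, internal audit signed; external expert review pending)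

Support file (`--supports stmt-CriticalPhenomena-4575`), QUANT lane seat prim-quant-census-2 (gen 60), rung R8 of
`run/shared/lean/prim/quant/LADDER.md`.  Memo `run/shared/lean/prim/quant/prim-quant-census-2-g60/TWO-MID-G60.md` §3–§4.  Theorems only,
standard axioms, no sorries, no definitions.  Setting and notation as in `…TwoMidCellRates`.

Bracket 1 prices the expensive-row lows `P1 = p+l` (mass `(1−γ)m_E`) and `M1 = m+l` (mass `γ m_E`) against the second mid `p + h` (mass
`(1−γ)m_E c₁`) and `M1`'s giant share; its minimum over the price is `≥ −m_C·ℓ`, `ℓ = 2ra·max(1−2γ, 0)`, by one of three routes: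
* CAP ROUTE (`α_{P1} ≤ 1`): needs only `m_E(1−2γ) ≤ m_C ℓ`, i.e. `κ := m_E/m_C = (x−c)(1−ρe)/((1+x−c)(ρe−x)) ≤ 2ra`; this holds when `P1`
  is incompatible (`(1−ρe)ε ≤ ra`: **`R_E`**, certificate E) or nearly so (`(1−ρe)ε ≤ 2ra`: **`R_E2`**, certificate E2) — and trivially when
  `γ ≥ 1/2`.
* LIGHT `M1` (`ρ_N ≤ x`) away from incompatibility (`2ra/ε ≤ 1 − ρe`): the breakpoint value `w` at `β = 1/U_{P1}` is NONNEGATIVE —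
  **`R_L`**, from the 109-term certificate L1 in the variables `(x, r, g₀ = ρe − x, t = η − g₀)` (the identities `ρ_N = x − t`,
  `δ = rη/(1+s−r+η)` make `ε` and `a` disappear).  (Near incompatibility `w < 0` does occur — at `c → x`, where `κ → 0` — whence the cap route.)
* HEAVY `M1` (`x ≤ ρ_N`): the COUPLING **`R_F`**: `(x − c)·N′ ≤ ℓ(ρe + δ)(1+x−c)(ρe−x)((1−ρe)+η)` where
  `N′ = (1−γ)δ((1−ρe)+η) − γ(δ+η)(1−ρe)` is the numerator of `−w`; proof: after clearing `ε(ε−a)`, `N″ = ra((1−γ)(1−r)+γs) − sεK` with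
  `K = x(x−r) + rγ + γs ≥ 0` and `sε ≥ ra` give `N″ ≤ ra(1−2γ)` and, when `N″ > 0`, the bound `s(2−r)(x(x−r)+rγ) ≤ cr(1−γ)(1−r)`, under
  which the certificate F4 controls `(x−c)(1+s)` by `2(1−s)(2−c)(1−r)(1+x−c)(1−x−s)`.

[this work].  The gluing rows served [cite: KozmaNitzan2024, Conjecture 3 (p. 15)]; product measure [cite: Grimmett1999, §1.3 p. 10].
-/

noncomputable section

namespace Summit.CriticalPhenomena.PercolationContinuityZ3.Theorems

namespace Quant

namespace LawDec

namespace TwoMidCell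

/-- light usage `U_ℓ(ρ) = (x² + (1−x)ρ)/((1−x)(1+x−ρ))` -/
local notation3 "UL[" x ", " ρ "]" => ((x : ℝ) ^ 2 + (1 - x) * ρ) / ((1 - x) * (1 + x - ρ))

/-! ### bracket 1: the cap route and the light case -/

/-- case 1b: `P1` incompatible (`(1 − ρe)·ε ≤ r·a`) ⟹ `κ ≤ 2ra` in cleared form. -/
theorem R_E (x r c a ρe ε γ : ℝ) (hγ : γ = x ^ 2 + (1 - x) * r) (hx0 : 0 < x) (hx1 : x < 1) (hr0 : 0 ≤ r) (hrx : r < x)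
    (hcx : c < x) (ha0 : 0 < a) (ha1 : a < 1)
    (hlc : (2 - r) * a < c) (hρe : x < ρe) (hρe1 : ρe < 1) (hd : 2 - c ≤ ε * (2 - ρe)) (hg : γ ≤ 1 / 2)
    (hinc : (1 - ρe) * ε ≤ r * a) :
    (x - c) * (1 - ρe) ≤ 2 * r * a * ((1 + x - c) * (ρe - x)) := by
  subst hγ
  obtain ⟨s, hs⟩ : ∃ s : ℝ, s = 1 - ρe := ⟨_, rfl⟩
  have eρ : ρe = 1 - s := by linarith
  subst eρ
  have hs0 : 0 < s := by linarith
  have hra0 : 0 ≤ r * a := mul_nonneg hr0 ha0.le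
  have hc0 : 0 < c := by nlinarith
  have hε0 : 0 < ε := by nlinarith
  -- `s(2 − c) ≤ s ε (1+s) ≤ r a (1+s)`
  have hH1b : 0 ≤ r * a * s + c * s + r * a - 2 * s := by
    have h1 : s * (2 - c) ≤ s * (ε * (1 + s)) := mul_le_mul_of_nonneg_left (by linarith) hs0.le
    have h2 : s * (ε * (1 + s)) ≤ r * a * (1 + s) := by
      have := mul_le_mul_of_nonneg_right hinc (by linarith : (0:ℝ) ≤ 1 + s)
      linarith [this]
    linarith
  have hC := poly_E x r c a s hx0.le (by linarith) hr0 (by linarith) hc0.le (by linarith) ha0.le (by linarith) (by linarith)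
    hs0.le (by linarith) (by linarith) hH1b
  have t0 : (x - c) * (1 + s) ≤ 2 * (2 - c) * (1 + x - c) * (1 - x - s) * (1 - s) := by linarith
  have hP0 : 0 ≤ 2 * (2 - c) * (1 + x - c) * (1 - x - s) :=
    mul_nonneg (mul_nonneg (by linarith) (by linarith)) (by linarith)
  have t1 : 2 * (2 - c) * (1 + x - c) * (1 - x - s) * (1 - s) ≤ 2 * (2 - c) * (1 + x - c) * (1 - x - s) := by
    nlinarith
  have t2 : (x - c) * s * (2 - c) ≤ (x - c) * (r * a * (1 + s)) := by
    have := mul_le_mul_of_nonneg_left (show s * (2 - c) ≤ r * a * (1 + s) by linarith) (by linarith : (0:ℝ) ≤ x - c)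
    linarith
  have t3 := mul_le_mul_of_nonneg_left (t0.trans t1) hra0
  have key : (x - c) * s * (2 - c) ≤ (2 * r * a * ((1 + x - c) * (1 - x - s))) * (2 - c) := by linarith
  have := le_of_mul_le_mul_right key (by linarith : (0:ℝ) < 2 - c)
  have e1 : (1:ℝ) - (1 - s) = s := by ring
  have e2 : (1:ℝ) - s - x = 1 - x - s := by ring
  rw [e1, e2]; exact this


set_option maxHeartbeats 4000000 in
/-- **(E2) near-incompatible `P1`** (`(1−ρe)ε ≤ 2ra`): `κ ≤ 2ra` in cleared form. [this work] -/
theorem R_E2 (x r c a ρe ε γ : ℝ) (hγ : γ = x ^ 2 + (1 - x) * r) (hx0 : 0 < x) (hx1 : x < 1) (hr0 : 0 ≤ r) (hrx : r < x)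
    (hcx : c < x) (ha0 : 0 < a) (ha1 : a < 1)
    (hlc : (2 - r) * a < c) (hρe : x < ρe) (hρe1 : ρe < 1) (hd : 2 - c ≤ ε * (2 - ρe)) (hg : γ ≤ 1 / 2)
    (hinc : (1 - ρe) * ε ≤ 2 * (r * a)) :
    (x - c) * (1 - ρe) ≤ 2 * r * a * ((1 + x - c) * (ρe - x)) := by
  subst hγ
  obtain ⟨s, hs⟩ : ∃ s : ℝ, s = 1 - ρe := ⟨_, rfl⟩
  have eρ : ρe = 1 - s := by linarith
  subst eρ
  have hs0 : 0 < s := by linarith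
  have hra0 : 0 ≤ r * a := mul_nonneg hr0 ha0.le
  have hc0 : 0 < c := by nlinarith
  have hε0 : 0 < ε := by nlinarith
  -- `s(2 − c) ≤ s ε (1+s) ≤ 2 r a (1+s)`
  have hH2b : 0 ≤ 2 * r * a * (1 + s) - s * (2 - c) := by
    have h1 : s * (2 - c) ≤ s * (ε * (1 + s)) := mul_le_mul_of_nonneg_left (by linarith) hs0.le
    have h2 : s * (ε * (1 + s)) ≤ 2 * (r * a) * (1 + s) := by
      have := mul_le_mul_of_nonneg_right hinc (by linarith : (0:ℝ) ≤ 1 + s)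
      linarith [this]
    linarith
  have hC := poly_E2 x r c a s (by linarith) hr0 (by linarith) hc0.le (by linarith) ha0.le (by linarith) (by linarith) hs0.le (by linarith) (by linarith) (by linarith [hH2b]) (by linarith) (by linarith) (by linarith) (by linarith)
  have t0 : (x - c) * (1 + s) ≤ (2 - c) * (1 + x - c) * (1 - x - s) := by linarith
  have t2 : (x - c) * s * (2 - c) ≤ (x - c) * (2 * r * a * (1 + s)) := by
    have := mul_le_mul_of_nonneg_left (show s * (2 - c) ≤ 2 * r * a * (1 + s) by linarith) (by linarith : (0:ℝ) ≤ x - c)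
    linarith
  have t3 := mul_le_mul_of_nonneg_left t0 (by nlinarith : (0:ℝ) ≤ 2 * r * a)
  have key : (x - c) * s * (2 - c) ≤ (2 * r * a * ((1 + x - c) * (1 - x - s))) * (2 - c) := by linarith
  have := le_of_mul_le_mul_right key (by linarith : (0:ℝ) < 2 - c)
  have e1 : (1:ℝ) - (1 - s) = s := by ring
  have e2 : (1:ℝ) - s - x = 1 - x - s := by ring
  rw [e1, e2]; exact this


set_option maxHeartbeats 4000000 in
/-- **(L) light `M1` away from incompatibility** (`2δ ≤ 1 − ρe`, `ρN ≤ x`): `w ≥ 0` in closed form, from the certificate `poly_L1` in the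
variables `(x, r, g₀, t)` with `g₀ = ρe − x`, `t = η − g₀ ≥ 0` (so `ρN = x − t`, `δ = rη/(1+s−r+η)`). [this work] -/
theorem R_L (x r c a ρe ε γ ρS ρN : ℝ) (hγ : γ = x ^ 2 + (1 - x) * r) (hρS : ρS = ρe + r * a / ε)
    (hρN : ρN = ρe - a * (2 - ρe - r) / (ε - a))
    (hx0 : 0 < x) (hx1 : x < 1) (hr0 : 0 ≤ r) (hrx : r < x) (hcx : c < x) (ha0 : 0 < a) (ha1 : a < 1)
    (hlc : (2 - r) * a < c) (hρe : x < ρe) (hρe1 : ρe < 1) (hd : 2 - c ≤ ε * (2 - ρe)) (hg : γ ≤ 1 / 2)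
    (hcomp2 : 2 * (r * a / ε) ≤ 1 - ρe) (hlight : ρN ≤ x) :
    (1 - γ) * (ρS / (1 - ρS) - ρe / (1 - ρe)) ≤ γ * (ρS / (1 - ρS) - UL[x, ρN]) := by
  obtain ⟨s, hs⟩ : ∃ s : ℝ, s = 1 - ρe := ⟨_, rfl⟩
  have eρ : ρe = 1 - s := by linarith
  subst eρ
  have hs0 : 0 < s := by linarith
  have h1x : 0 < 1 - x := by linarith
  have hra0 : 0 ≤ r * a := mul_nonneg hr0 ha0.le
  have hc0 : 0 < c := by nlinarith
  have hγ0 : 0 ≤ γ := by rw [hγ]; nlinarith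
  have hε1 : 1 ≤ ε := by
    by_contra hlt; push Not at hlt
    have : ε * (2 - (1 - s)) < 1 * (2 - (1 - s)) := mul_lt_mul_of_pos_right hlt (by linarith)
    linarith
  have hε0 : 0 < ε := by linarith
  have hεa : 0 < ε - a := by linarith
  -- coordinates g₀, η, t, δ
  obtain ⟨g0, hg0⟩ : ∃ g0 : ℝ, g0 = 1 - s - x := ⟨_, rfl⟩
  obtain ⟨η, hη⟩ : ∃ η : ℝ, η = a * (1 + s - r) / (ε - a) := ⟨_, rfl⟩
  obtain ⟨t, ht⟩ : ∃ t : ℝ, t = η - g0 := ⟨_, rfl⟩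
  obtain ⟨δ, hδ⟩ : ∃ δ : ℝ, δ = r * a / ε := ⟨_, rfl⟩
  have hg00 : 0 < g0 := by rw [hg0]; linarith
  have hηε : η * (ε - a) = a * (1 + s - r) := by rw [hη]; field_simp
  have hδε : δ * ε = r * a := by rw [hδ]; field_simp
  have eN : ρN = x - t := by rw [hρN, ht, hη, hg0]; ring_nf
  have ht0 : 0 ≤ t := by linarith [hlight]
  have eS : ρS = 1 - s + δ := by rw [hρS, hδ]
  have hδ2 : 2 * δ ≤ s := by rw [hδ]; linarith [hcomp2]
  have hδ0 : 0 ≤ δ := by rw [hδ]; positivity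
  -- `δ = r η / (1 + s − r + η)` : from `η ε = a(1+s−r+η)`
  have hD0 : 0 < 1 + s - r + η := by
    have : 0 ≤ η := by rw [hη]; exact div_nonneg (mul_nonneg ha0.le (by linarith)) hεa.le
    linarith
  have haε : a * (1 + s - r + η) = η * ε := by linarith [hηε]
  have hδD : δ * (1 + s - r + η) = r * η := by
    have : δ * (1 + s - r + η) * ε = r * η * ε := by
      calc δ * (1 + s - r + η) * ε = (δ * ε) * (1 + s - r + η) := by ring
        _ = r * (a * (1 + s - r + η)) := by rw [hδε]; ring
        _ = r * η * ε := by rw [haε]; ring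
    exact mul_right_cancel₀ hε0.ne' this
  -- the constraints of the certificate in `(x, r, g₀, t)`
  have hcompat2 : 0 ≤ (1 - x - g0) * (2 - x - r + t) - 2 * r * (g0 + t) := by
    have e1 : (1:ℝ) - x - g0 = s := by rw [hg0]; ring
    have e2 : (2:ℝ) - x - r + t = 1 + s - r + η := by rw [ht, hg0]; ring
    have e3 : g0 + t = η := by rw [ht]; ring
    rw [e1, e2, e3]
    have := mul_le_mul_of_nonneg_right hδ2 hD0.le
    nlinarith [hδD, this]
  have hetamax : 0 ≤ x * (1 + (1 - x - g0)) * (1 + (1 - x - g0) - r) - (g0 + t) * ((2 - r) * (2 - x) - x * (1 + (1 - x - g0))) := by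
    have e1 : (1:ℝ) - x - g0 = s := by rw [hg0]; ring
    have e3 : g0 + t = η := by rw [ht]; ring
    rw [e1, e3]
    -- `η(ε − a) = a(1+s−r)`, `(2−r)a < x`, `2 − x ≤ ε(1+s)` ⟹ `η[(2−r)(2−x) − x(1+s)] ≤ x(1+s)(1+s−r)`
    have h1 : (2 - r) * a ≤ x := by linarith
    have h2 : (2 - x) ≤ ε * (1 + s) := by linarith
    have hη0 : 0 ≤ η := by rw [hη]; exact div_nonneg (mul_nonneg ha0.le (by linarith)) hεa.le
    have u1 : η * ((2 - r) * (2 - x)) ≤ η * ((2 - r) * (ε * (1 + s))) :=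
      mul_le_mul_of_nonneg_left (mul_le_mul_of_nonneg_left h2 (by linarith)) hη0
    have u2 : η * ε = a * (1 + s - r) + η * a := by linarith [hηε]
    have u5 : η * ε * ((2 - r) * (1 + s)) = (a * (1 + s - r) + η * a) * ((2 - r) * (1 + s)) := by rw [u2]
    have u3 : (2 - r) * a * ((1 + s - r) * (1 + s)) ≤ x * ((1 + s - r) * (1 + s)) :=
      mul_le_mul_of_nonneg_right h1 (mul_nonneg (by linarith) (by linarith))
    have u4 : (2 - r) * a * (η * (1 + s)) ≤ x * (η * (1 + s)) :=
      mul_le_mul_of_nonneg_right h1 (mul_nonneg hη0 (by linarith))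
    linarith [u1, u5, u3, u4]
  have hP := poly_L1 x r g0 t hx0.le (by linarith) hr0 (by linarith) hg00.le (by linarith) ht0 (by linarith) (by linarith [hcompat2]) (by linarith [hetamax]) (by nlinarith [mul_nonneg hx0.le (sub_nonneg.2 hrx.le)]) (by linarith) (by linarith) (by linarith)
  -- the identity: `wsuff · (s − δ)(1−x) s · (2−x−r+t)(1+t) = Ω′`
  have hsd : 0 < s - δ := by linarith
  have hden1 : (1:ℝ) - (1 - s + δ) ≠ 0 := by linarith
  have hden2 : (1:ℝ) - x ≠ 0 := h1x.ne'
  have hden3 : (1:ℝ) + x - (x - t) ≠ 0 := by linarith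
  have hden4 : (1:ℝ) - (1 - s) ≠ 0 := by linarith
  rw [eS, eN]
  rw [← sub_nonneg]
  have key : (γ * ((1 - s + δ) / (1 - (1 - s + δ)) - UL[x, x - t]) - (1 - γ) * ((1 - s + δ) / (1 - (1 - s + δ)) - (1 - s) / (1 - (1 - s))))
      * ((s - δ) * (1 - x) * s * (1 + t))
      = γ * s * g0 * (1 + t) + γ * s * δ * (1 + t) - (1 - γ) * (1 - x) * δ * (1 + t) + γ * t * s * (s - δ) := by
    rw [hg0]
    field_simp
    ring
  have hposD : 0 < (s - δ) * (1 - x) * s * (1 + t) := by positivity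
  refine (mul_nonneg_iff_of_pos_right hposD).1 ?_
  rw [key]
  -- `Ω (1+t) (2−x−r+t) = Ω′ ≥ 0` with `δ (2−x−r+t) = r (g₀ + t)`
  have hD' : 0 < 2 - x - r + t := by linarith
  have hδD' : δ * (2 - x - r + t) = r * (g0 + t) := by
    have e2 : (2:ℝ) - x - r + t = 1 + s - r + η := by rw [ht, hg0]; ring
    have e3 : g0 + t = η := by rw [ht]; ring
    rw [e2, e3]; exact hδD
  refine (mul_nonneg_iff_of_pos_right hD').1 ?_
  have hs' : s = 1 - x - g0 := by rw [hg0]; ring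
  have e : (γ * s * g0 * (1 + t) + γ * s * δ * (1 + t) - (1 - γ) * (1 - x) * δ * (1 + t) + γ * t * s * (s - δ)) * (2 - x - r + t)
      = (1 + t) * (γ * s * g0 * (2 - x - r + t) + (γ * s - (1 - γ) * (1 - x)) * r * (g0 + t))
        + γ * t * s * (s * (2 - x - r + t) - r * (g0 + t)) := by
    linear_combination ((1 + t) * (γ * s - (1 - γ) * (1 - x)) - γ * t * s) * hδD'
  rw [e, hγ, hs']
  linarith [hP]


set_option maxHeartbeats 4000000 in
/-- **(F) heavy `M1`, the coupling core**: `(x − c)·N′ ≤ ℓ(ρe + δ)(1+x−c)(ρe−x)((1−ρe)+η)` with `ℓ = 2ra(1−2γ)`, from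
`N″ ≤ ra(1−2γ)` (compatibility of `P1` and `K ≥ 0`), the explicit bound on `1 − ρe` forced by `N″ > 0`, and the certificate `poly_F4`.
[this work] -/
theorem R_F (x r c a ρe ε γ δ η : ℝ) (hγ : γ = x ^ 2 + (1 - x) * r) (hδ : δ = r * a / ε) (hη : η = a * (2 - ρe - r) / (ε - a))
    (hx0 : 0 < x) (hx1 : x < 1) (hr0 : 0 ≤ r) (hrx : r < x) (hcx : c < x) (ha0 : 0 < a) (ha1 : a < 1)
    (hlc : (2 - r) * a < c) (hρe : x < ρe) (hρe1 : ρe < 1) (hd : 2 - c ≤ ε * (2 - ρe)) (hg : γ ≤ 1 / 2)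
    (hcomp : δ ≤ 1 - ρe) :
    (x - c) * ((1 - γ) * δ * ((1 - ρe) + η) - γ * (δ + η) * (1 - ρe))
      ≤ 2 * r * a * (1 - 2 * γ) * (ρe + δ) * ((1 + x - c) * (ρe - x) * ((1 - ρe) + η)) := by
  obtain ⟨s, hs⟩ : ∃ s : ℝ, s = 1 - ρe := ⟨_, rfl⟩
  have eρ : ρe = 1 - s := by linarith
  subst eρ
  have hs0 : 0 < s := by linarith
  have hsx : s < 1 - x := by linarith
  have h1x : 0 < 1 - x := by linarith
  have hra0 : 0 ≤ r * a := mul_nonneg hr0 ha0.le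
  have hc0 : 0 < c := by nlinarith
  have hγ0 : 0 ≤ γ := by rw [hγ]; nlinarith
  have hε1 : 1 ≤ ε := by
    by_contra hlt; push Not at hlt
    have : ε * (2 - (1 - s)) < 1 * (2 - (1 - s)) := mul_lt_mul_of_pos_right hlt (by linarith)
    linarith
  have hε0 : 0 < ε := by linarith
  have hεa : 0 < ε - a := by linarith
  -- the cleared quantities
  obtain ⟨Q1, hQ1⟩ : ∃ Q1 : ℝ, Q1 = (1 - s) * ε + r * a := ⟨_, rfl⟩
  obtain ⟨Q2, hQ2⟩ : ∃ Q2 : ℝ, Q2 = s * ε + a * (1 - r) := ⟨_, rfl⟩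
  obtain ⟨N, hN⟩ : ∃ N : ℝ, N = (1 - γ) * r * Q2 - γ * s * (ε * (1 + s) - r * a) := ⟨_, rfl⟩
  have hQ1e : (1 - s + δ) * ε = Q1 := by rw [hQ1, hδ]; field_simp
  have hQ2e : (s + η) * (ε - a) = Q2 := by
    rw [hQ2, hη]; field_simp; ring
  have hNe : ((1 - γ) * δ * (s + η) - γ * (δ + η) * s) * (ε * (ε - a)) = a * N := by
    rw [hN, hQ2, hδ, hη]; field_simp; ring
  have hQ10 : 0 < Q1 := by rw [hQ1]; nlinarith
  have hQ20 : 0 < Q2 := by rw [hQ2]; nlinarith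
  -- it suffices to prove the cleared inequality `(x−c) N ≤ 2 r (1−2γ) Q1 (1+x−c)(1−x−s) Q2`
  suffices hcl : (x - c) * N ≤ 2 * r * (1 - 2 * γ) * Q1 * ((1 + x - c) * (1 - x - s)) * Q2 by
    -- multiply the goal by `ε(ε−a) > 0`
    have hpos : 0 < ε * (ε - a) := mul_pos hε0 hεa
    refine le_of_mul_le_mul_right ?_ hpos
    have e1 : (x - c) * ((1 - γ) * δ * (s + η) - γ * (δ + η) * s) * (ε * (ε - a)) = (x - c) * (a * N) := by
      rw [← hNe]; ring
    have e2 : 2 * r * a * (1 - 2 * γ) * (1 - s + δ) * ((1 + x - c) * (1 - s - x) * (s + η)) * (ε * (ε - a))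
        = a * (2 * r * (1 - 2 * γ) * ((1 - s + δ) * ε) * ((1 + x - c) * (1 - x - s)) * ((s + η) * (ε - a))) := by ring
    have e0 : (1:ℝ) - (1 - s) = s := by ring
    rw [e0, e1, e2, hQ1e, hQ2e]
    nlinarith [mul_le_mul_of_nonneg_left hcl ha0.le]
  -- case `N ≤ 0`: trivial
  rcases le_or_gt N 0 with hN0 | hN0
  · have : (x - c) * N ≤ 0 := mul_nonpos_of_nonneg_of_nonpos (by linarith) hN0
    have : 0 ≤ 2 * r * (1 - 2 * γ) * Q1 * ((1 + x - c) * (1 - x - s)) * Q2 := by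
      have h1 : 0 ≤ 2 * r * (1 - 2 * γ) := by nlinarith
      have h2 : 0 ≤ 2 * r * (1 - 2 * γ) * Q1 := mul_nonneg h1 hQ10.le
      have h3 : 0 ≤ 2 * r * (1 - 2 * γ) * Q1 * ((1 + x - c) * (1 - x - s)) := mul_nonneg h2 (mul_nonneg (by linarith) (by linarith))
      exact mul_nonneg h3 hQ20.le
    linarith
  -- `N = ra((1−γ)(1−r) + γ s) − s ε K` with `K = γ(1+s) − r(1−γ) = x(x−r) + rγ + γ s ≥ 0`
  have hK : γ * (1 + s) - r * (1 - γ) = x * (x - r) + r * γ + γ * s := by rw [hγ]; ring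
  have hK0 : 0 ≤ γ * (1 + s) - r * (1 - γ) := by rw [hK]; nlinarith [mul_nonneg hr0 hγ0, mul_nonneg hγ0 hs0.le]
  have hNform : N = r * a * ((1 - γ) * (1 - r) + γ * s) - s * ε * (γ * (1 + s) - r * (1 - γ)) := by rw [hN, hQ2]; ring
  -- compatibility: `r a ≤ s ε`
  have hse : r * a ≤ s * ε := by
    have := hcomp; rw [hδ, div_le_iff₀ hε0] at this; linarith
  -- (a) `N ≤ r a (1 − 2γ)`
  have hNle : N ≤ r * a * (1 - 2 * γ) := by
    rw [hNform]
    have := mul_le_mul_of_nonneg_right hse hK0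
    nlinarith
  -- (b) the bound on `s`: `s (2−r)(x(x−r) + rγ) ≤ c r (1−γ)(1−r)`
  have hsb : 0 ≤ c * r * (1 - γ) * (1 - r) - s * (2 - r) * (x * (x - r) + r * γ) := by
    -- from `N > 0`: `s ε (x(x−r) + rγ) + γ s (s ε − r a) < r a (1−γ)(1−r)`, with `s ε ≥ r a`, `ε ≥ 1`, `(2−r) a ≤ c`
    have h1 : s * ε * (x * (x - r) + r * γ) ≤ r * a * ((1 - γ) * (1 - r)) := by
      have : 0 < N := hN0
      rw [hNform, hK] at this
      nlinarith [mul_nonneg hγ0 (mul_nonneg hs0.le (sub_nonneg.2 hse))]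
    have hB0 : 0 ≤ x * (x - r) + r * γ := by nlinarith [mul_nonneg hr0 hγ0]
    have h2 : s * (x * (x - r) + r * γ) ≤ s * ε * (x * (x - r) + r * γ) := by
      have := mul_le_mul_of_nonneg_left hε1 (mul_nonneg hs0.le hB0); linarith [this]
    have h3 : r * a * ((1 - γ) * (1 - r)) * (2 - r) ≤ c * r * ((1 - γ) * (1 - r)) := by
      have := mul_le_mul_of_nonneg_left hlc.le (mul_nonneg hr0 (mul_nonneg (by linarith : (0:ℝ) ≤ 1 - γ) (by linarith : (0:ℝ) ≤ 1 - r)))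
      linarith [this]
    nlinarith [mul_le_mul_of_nonneg_right (h2.trans h1) (by linarith : (0:ℝ) ≤ 2 - r)]
  -- (c) the certificate
  have hsb' := hsb
  rw [hγ] at hsb'
  have hBxpos : 0 < x * (x - r) + r * (x ^ 2 + (1 - x) * r) := by
    have h1 : r * (1 - x) < x * (1 - x) := mul_lt_mul_of_pos_right hrx h1x
    have h2 : 0 ≤ r * r * (1 - x) := mul_nonneg (mul_nonneg hr0 hr0) h1x.le
    nlinarith [mul_pos (mul_pos hx0 hx0) hx0, mul_lt_mul_of_pos_left h1 hx0]
  have hP := poly_F4b x r c s hx0.le (by linarith) hr0 (by linarith) hc0.le (by linarith) hs0.le (by linarith) (by linarith)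
    (by linarith [hsb']) (by linarith) (by linarith) (by linarith) (by linarith) (by linarith)
    (by nlinarith [mul_nonneg hx0.le (sub_nonneg.2 hrx.le)]) (by nlinarith [mul_nonneg (sub_nonneg.2 hx1.le) (sub_nonneg.2 hrx.le)])
    (by linarith [hBxpos])
  have hP' : 0 ≤ (2 * (1 - s) * (2 - c) * (1 - r) * (1 + x - c) * (1 - x - s) - (x - c) * (1 + s))
      * (x * (x - r) + r * (x ^ 2 + (1 - x) * r)) := by linear_combination hP
  have hPdd : (x - c) * (1 + s) ≤ 2 * (1 - s) * (2 - c) * (1 - r) * (1 + x - c) * (1 - x - s) :=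
    sub_nonneg.1 ((mul_nonneg_iff_of_pos_right hBxpos).1 hP')
  clear hP hP' hsb' hsb
  -- (d) assemble: `(x−c) N ≤ (x−c) r a (1−2γ) ≤ 2 r (1−2γ) Q1 (1+x−c)(1−x−s) Q2`
  have hQ1lo : (1 - s) * ε ≤ Q1 := by rw [hQ1]; linarith
  have hQ2lo : a * (1 - r) ≤ Q2 := by rw [hQ2]; nlinarith
  have hεlo : 2 - c ≤ ε * (1 + s) := by linarith
  have step1 : (x - c) * N ≤ (x - c) * (r * a * (1 - 2 * γ)) := mul_le_mul_of_nonneg_left hNle (by linarith)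
  -- `(x−c) a (1+s) ≤ 2 (1−s)(2−c)(1−r)(1+x−c)(1−x−s) a ≤ 2 (1−s) ε (1+s) (1−r)(1+x−c)(1−x−s) a ≤ 2 Q1 Q2 (1+x−c)(1−x−s)(1+s)`
  have step2 : (x - c) * a * (1 + s) ≤ 2 * Q1 * Q2 * ((1 + x - c) * (1 - x - s)) * (1 + s) := by
    have u1 : (x - c) * a * (1 + s) ≤ 2 * (1 - s) * (2 - c) * (1 - r) * (1 + x - c) * (1 - x - s) * a := by
      nlinarith [mul_le_mul_of_nonneg_right hPdd ha0.le]
    have u2 : 2 * (1 - s) * (2 - c) * (1 - r) * (1 + x - c) * (1 - x - s) * a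
        ≤ 2 * (1 - s) * (ε * (1 + s)) * (1 - r) * (1 + x - c) * (1 - x - s) * a := by
      have hw : 0 ≤ 2 * (1 - s) * (1 - r) * (1 + x - c) * (1 - x - s) * a := by
        have : 0 ≤ (1 - s) * (1 - r) := mul_nonneg (by linarith) (by linarith)
        have : 0 ≤ (1 - s) * (1 - r) * (1 + x - c) := mul_nonneg this (by linarith)
        have : 0 ≤ (1 - s) * (1 - r) * (1 + x - c) * (1 - x - s) := mul_nonneg this (by linarith)
        nlinarith [mul_nonneg this ha0.le]
      nlinarith [mul_le_mul_of_nonneg_left hεlo hw]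
    have u3 : 2 * (1 - s) * (ε * (1 + s)) * (1 - r) * (1 + x - c) * (1 - x - s) * a
        = 2 * ((1 - s) * ε) * (a * (1 - r)) * ((1 + x - c) * (1 - x - s)) * (1 + s) := by ring
    have u4 : 2 * ((1 - s) * ε) * (a * (1 - r)) * ((1 + x - c) * (1 - x - s)) * (1 + s)
        ≤ 2 * Q1 * Q2 * ((1 + x - c) * (1 - x - s)) * (1 + s) := by
      have hw1 : 0 ≤ ((1 + x - c) * (1 - x - s)) * (1 + s) := mul_nonneg (mul_nonneg (by linarith) (by linarith)) (by linarith)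
      have := mul_le_mul hQ1lo hQ2lo (mul_nonneg ha0.le (by linarith)) hQ10.le
      nlinarith [mul_le_mul_of_nonneg_right this hw1]
    linarith [u1, u2, u3.le, u3.ge, u4]
  have step3 : (x - c) * a ≤ 2 * Q1 * Q2 * ((1 + x - c) * (1 - x - s)) :=
    le_of_mul_le_mul_right (by linarith [step2]) (by linarith : (0:ℝ) < 1 + s)
  have h12γ : 0 ≤ r * (1 - 2 * γ) := mul_nonneg hr0 (by linarith)
  calc (x - c) * N ≤ (x - c) * (r * a * (1 - 2 * γ)) := step1
    _ = (r * (1 - 2 * γ)) * ((x - c) * a) := by ring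
    _ ≤ (r * (1 - 2 * γ)) * (2 * Q1 * Q2 * ((1 + x - c) * (1 - x - s))) := mul_le_mul_of_nonneg_left step3 h12γ
    _ = 2 * r * (1 - 2 * γ) * Q1 * ((1 + x - c) * (1 - x - s)) * Q2 := by ring


end TwoMidCell

end LawDec

end Quant

end Summit.CriticalPhenomena.PercolationContinuityZ3.Theorems
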